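import Mathlib
import Literature.Algebra.Polynomial.CorrelativeSparsityCertificates
import HarnessLib

/-!
# The running intersection property alone does not make sparse SOS certificates exist:
# Nie–Demmel's Example 3.5, exactly (sparse bound `= 0` at every degree, `f ≥ 1/4`)

Topic `Literature/Algebra/Polynomial`, namespace
`Literature.Algebra.Polynomial.SparseSosWithoutCompactness`.  The CEILING companion of
`SparsePutinarPositivstellensatz.lean` (Lasserre / Grimm–Netzer–Schweighofer: with ARCHIMEDEAN block
modules, sparse Putinar certificates exist) and `CorrelativeSparsityCertificates.lean` (with the
redundant ball constraints they exist): WITHOUT compactness the correlative-sparsity SOS bound can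
stay at `0` at every relaxation order although the blocks satisfy the running intersection
property, `f` is a sparse sum of squares itself, and `f ≥ 1/4 > 0`.

## Sources, read on the page

* J. Nie, J. Demmel, *Sparse SOS relaxations for minimizing functions that are summations of small
  polynomials*, SIAM J. Optim. 19 (2008) 1534–1558 [held text `paper:arxiv-math_0606476`, chunk
  p0007]: **Remark 3.4.** «The running intersection property (2.4) alone is not sufficient to
  guarantee the equality `f*_Δ = f*_sos`, as shown by the following example.»  **Example 3.5.**
  «`f(x) = f_1(x_1,x_2) + f_2(x_2,x_3)` where `f_1 = x_1⁴ + (x_1 x_2 − 1)²` and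
  `f_2 = x_2² x_3² + (x_3² − 1)²`.  Solving dense SOS relaxation … and sparse SOS relaxation …
  numerically, we find that `f*_Δ ≈ 5.0 · 10⁻⁵ < f*_sos ≈ 0.8499`.  Actually the minimum
  `f* ≈ 0.8650`.» (followed by a proof that `f*` is attained; «both the dense and sparse SOS
  relaxation are not exact: `f*_Δ < f*_sos < f*`»).  Here `f*_Δ` is the value of the sparse SOS
  relaxation (2.8)–(2.10) of the paper, `sup γ s.t. f − γ ∈ Σ_i Σℝ[x_{Δ_i}]²`, blocks
  `Δ_1 = {1,2}`, `Δ_2 = {2,3}` (which satisfy (2.4) = RIP, trivially for two blocks).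
* V. Magron, J. Wang, *Sparse polynomial optimization: theory and practice* (2022/2023) [held text
  `paper:arxiv-2208.11158`, chunk p0119], appendix «SOS + sparse + RIP ≠ sparse SOS»: the same
  `f_1, f_2`, «Here the RIP trivially holds as we have only two subsets of variables … we obtain
  `f²_cs = 0.0005 < 0.8498 = f²`».

## What is formalised — an EXACT version of the printed numerics (all proved; no named facts)

Variables `x_0, x_1, x_2` (`Fin 3`; the papers' `x_1, x_2, x_3`), `f₁ = x_0⁴ + (x_0 x_1 − 1)²`,
`f₂ = x_1² x_2² + (x_2² − 1)²`, `f = f₁ + f₂`.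
* `f₁_mem_supported`, `f₂_mem_supported` (`f₁ ∈ ℝ[x_0,x_1]`, `f₂ ∈ ℝ[x_1,x_2]`: the two blocks, RIP
  trivially — `indexedRunningIntersection_blocks`); `isBlockSos_f₁`, `isBlockSos_f₂` — `f` IS a
  sparse sum of squares, so the sparse bound `γ = 0` is attained;
* ★ `quarter_le_eval_f` — `f ≥ 1/4` on `ℝ³` (so `f* ≥ 1/4`; the printed `f* ≈ 0.8650` is not
  claimed);
* ★★ `no_sparse_nonneg_certificate` — for every `γ > 0` there are NO `σ₁ ∈ ℝ[x_0,x_1]`,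
  `σ₂ ∈ ℝ[x_1,x_2]`, nonnegative on `ℝ³` (in particular: no sums of squares, of any degree), with
  `f − γ = σ₁ + σ₂`.  Proof: `h := σ₁ − f₁ = f₂ − γ − σ₂` depends on `x_1` alone; `σ₂ ≥ 0` at
  `x_2 = 0` gives `h ≤ 1 − γ`, `σ₁ ≥ 0` at `x_0 = 0` gives `h ≥ −1`, so the univariate polynomial
  `h` is bounded, hence constant `c`; `σ₂ ≥ 0` at `(x_1,x_2) = (0,1)` gives `c ≤ −γ < 0`, while
  `σ₁ ≥ 0` at `x_0 = 1/x_1` gives `c ≥ −1/x_1⁴ → 0` — contradiction.  Hence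
  ★★ `sparseSosBound_eq_zero`: the set of sparse-certified lower bounds
  `{γ | f − γ ∈ Σ[x_0,x_1]-block-SOS + Σ[x_1,x_2]-block-SOS}` is exactly `(−∞, 0]` — the printed
  `f*_Δ ≈ 5·10⁻⁵` is `f*_Δ = 0` EXACTLY and at EVERY relaxation order — although `f ≥ 1/4`;
* ★ `exists_sparse_certificate_with_balls` — the contrast (CorrelativeSparsityCertificates): for
  every `γ < 1/4` and every radius² `N`, `f − γ` DOES have a block certificate once the redundant
  ball constraints `N − x_0² − x_1² ≥ 0`, `N − x_1² − x_2² ≥ 0` are adjoined (Lasserre's (3.1)) —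
  compactness is exactly what is missing in Example 3.5.

Not claimed: the numerical values `f*_sos ≈ 0.8499`, `f* ≈ 0.8650`, the attainment of `f*`
(Nie–Demmel's second paragraph), Corollary 3.6 (quadratic case).

## References

* [NieDemmel2008] J. Nie, J. Demmel, *Sparse SOS relaxations for minimizing functions that are
  summations of small polynomials*, SIAM J. Optim. 19 (2008) 1534–1558, doi:10.1137/060668791
  (arXiv:math/0606476) — Remark 3.4, Example 3.5.
* [MagronWang2022] V. Magron, J. Wang, *Sparse Polynomial Optimization: Theory and Practice*,
  World Scientific (2023), arXiv:2208.11158 — Appendix «SOS + sparse + RIP ≠ sparse SOS».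
* [Lasserre2006] J. B. Lasserre, SIAM J. Optim. 17 (2006) 822–843 — (3.1), Corollary 3.9 (the
  contrast, through `CorrelativeSparsityCertificates.sparse_putinar_of_blockCover`).
-/

noncomputable section

open MvPolynomial Finset Filter

open scoped BigOperators Polynomial

namespace Literature.Algebra.Polynomial.SparseSosWithoutCompactness

open Literature.Algebra.Polynomial.SparsePutinarPositivstellensatz (eval_eq_of_mem_supported
  C_mem_supported rename_mem_supported exists_eq_rename_of_mem_supported)
open Literature.Algebra.Polynomial.CorrelativeSparsityCertificates (IsBlockSos blockBall
  sparse_putinar_of_blockCover isSumSq_rename)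
open Literature.Combinatorics.SimpleGraph (IndexedRunningIntersection)

/-! ### The data of Example 3.5 -/

/-- `f₁ = x_0⁴ + (x_0 x_1 − 1)²` (the paper's `x_1⁴ + (x_1x_2 − 1)²`). [cite: NieDemmel2008, Example 3.5] -/
def f₁ : MvPolynomial (Fin 3) ℝ := X 0 ^ 4 + (X 0 * X 1 - 1) ^ 2

/-- `f₂ = x_1² x_2² + (x_2² − 1)²` (the paper's `x_2²x_3² + (x_3² − 1)²`). [cite: NieDemmel2008, Example 3.5] -/
def f₂ : MvPolynomial (Fin 3) ℝ := X 1 ^ 2 * X 2 ^ 2 + (X 2 ^ 2 - 1) ^ 2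

/-- `f = f₁ + f₂`. [cite: NieDemmel2008, Example 3.5] -/
def f : MvPolynomial (Fin 3) ℝ := f₁ + f₂

/-- The first block `Δ₁ = {x_0, x_1}`. [cite: NieDemmel2008, Example 3.5] -/
def Δ₁ : Finset (Fin 3) := {0, 1}

/-- The second block `Δ₂ = {x_1, x_2}`. [cite: NieDemmel2008, Example 3.5] -/
def Δ₂ : Finset (Fin 3) := {1, 2}

/-- The two blocks as a family. [cite: NieDemmel2008, Example 3.5] -/
def blocks : Fin 2 → Finset (Fin 3) := ![Δ₁, Δ₂]

/-- [cite: NieDemmel2008, Example 3.5] -/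
@[simp] theorem blocks_zero : blocks 0 = Δ₁ := rfl

/-- [cite: NieDemmel2008, Example 3.5] -/
@[simp] theorem blocks_one : blocks 1 = Δ₂ := rfl

/-- [cite: NieDemmel2008, Example 3.5] -/
@[simp] theorem eval_f₁ (x : Fin 3 → ℝ) : eval x f₁ = x 0 ^ 4 + (x 0 * x 1 - 1) ^ 2 := by
  simp [f₁]

/-- [cite: NieDemmel2008, Example 3.5] -/
@[simp] theorem eval_f₂ (x : Fin 3 → ℝ) : eval x f₂ = x 1 ^ 2 * x 2 ^ 2 + (x 2 ^ 2 - 1) ^ 2 := by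
  simp [f₂]

/-- [cite: NieDemmel2008, Example 3.5] -/
theorem eval_f (x : Fin 3 → ℝ) :
    eval x f = x 0 ^ 4 + (x 0 * x 1 - 1) ^ 2 + (x 1 ^ 2 * x 2 ^ 2 + (x 2 ^ 2 - 1) ^ 2) := by
  simp [f]

/-- `f₁ ∈ ℝ[x_0, x_1]`. [cite: NieDemmel2008, Example 3.5] -/
theorem f₁_mem_supported : f₁ ∈ supported ℝ (Δ₁ : Set (Fin 3)) := by
  have h0 : (X 0 : MvPolynomial (Fin 3) ℝ) ∈ supported ℝ (Δ₁ : Set (Fin 3)) :=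
    X_mem_supported.2 (by simp [Δ₁])
  have h1 : (X 1 : MvPolynomial (Fin 3) ℝ) ∈ supported ℝ (Δ₁ : Set (Fin 3)) :=
    X_mem_supported.2 (by simp [Δ₁])
  unfold f₁
  exact Subalgebra.add_mem _ (Subalgebra.pow_mem _ h0 _)
    (Subalgebra.pow_mem _ (Subalgebra.sub_mem _ (Subalgebra.mul_mem _ h0 h1)
      (Subalgebra.one_mem _)) _)

/-- `f₂ ∈ ℝ[x_1, x_2]`. [cite: NieDemmel2008, Example 3.5] -/
theorem f₂_mem_supported : f₂ ∈ supported ℝ (Δ₂ : Set (Fin 3)) := by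
  have h1 : (X 1 : MvPolynomial (Fin 3) ℝ) ∈ supported ℝ (Δ₂ : Set (Fin 3)) :=
    X_mem_supported.2 (by simp [Δ₂])
  have h2 : (X 2 : MvPolynomial (Fin 3) ℝ) ∈ supported ℝ (Δ₂ : Set (Fin 3)) :=
    X_mem_supported.2 (by simp [Δ₂])
  unfold f₂
  exact Subalgebra.add_mem _ (Subalgebra.mul_mem _ (Subalgebra.pow_mem _ h1 _)
    (Subalgebra.pow_mem _ h2 _))
    (Subalgebra.pow_mem _ (Subalgebra.sub_mem _ (Subalgebra.pow_mem _ h2 _)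
      (Subalgebra.one_mem _)) _)

/-- The two blocks satisfy the running intersection property (void for the first block, trivial
for the second: «the RIP trivially holds as we have only two subsets of variables»).
[cite: MagronWang2022, Appendix «SOS + sparse + RIP ≠ sparse SOS» (arXiv p. 119)] -/
theorem indexedRunningIntersection_blocks :
    IndexedRunningIntersection fun j => (blocks j : Set (Fin 3)) := by
  intro i hi
  refine ⟨0, Fin.pos_iff_ne_zero.2 (fun h => by simp [h] at hi), ?_⟩
  rintro v ⟨-, hv⟩
  rw [Literature.Combinatorics.SimpleGraph.mem_iUnionLT] at hv
  obtain ⟨j, hj, hvj⟩ := hv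
  have hj0 : j = 0 := by
    fin_cases i <;> fin_cases j <;> simp_all
  subst hj0
  exact hvj

/-! ### `f` is a sparse sum of squares and `f ≥ 1/4` -/

/-- A sum of two squares in a block ring is block-SOS. [cite: NieDemmel2008, Example 3.5] -/
private theorem isBlockSos_sq_add_sq (I : Set (Fin 3)) (a b : MvPolynomial I ℝ) :
    IsBlockSos I (rename ((↑) : I → Fin 3) (a ^ 2 + b ^ 2)) := by
  refine ⟨a ^ 2 + b ^ 2, ?_, rfl⟩
  rw [sq, sq, ← add_zero (b * b)]
  exact IsSumSq.sq_add a (IsSumSq.sq_add b IsSumSq.zero)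

/-- `f₁ = (x_0²)² + (x_0x_1 − 1)²` is a sum of squares of polynomials in `x_0, x_1`.
[cite: NieDemmel2008, Example 3.5] -/
theorem isBlockSos_f₁ : IsBlockSos (Δ₁ : Set (Fin 3)) f₁ := by
  have h0 : (0 : Fin 3) ∈ (Δ₁ : Set (Fin 3)) := by simp [Δ₁]
  have h1 : (1 : Fin 3) ∈ (Δ₁ : Set (Fin 3)) := by simp [Δ₁]
  have h := isBlockSos_sq_add_sq (Δ₁ : Set (Fin 3)) (X ⟨0, h0⟩ ^ 2) (X ⟨0, h0⟩ * X ⟨1, h1⟩ - 1)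
  have heq : rename ((↑) : ↥(Δ₁ : Set (Fin 3)) → Fin 3)
      ((X ⟨0, h0⟩ ^ 2) ^ 2 + (X ⟨0, h0⟩ * X ⟨1, h1⟩ - 1) ^ 2) = f₁ := by
    simp only [map_add, map_pow, map_sub, map_mul, map_one, rename_X, f₁]
    ring
  rwa [heq] at h

/-- `f₂ = (x_1x_2)² + (x_2² − 1)²` is a sum of squares of polynomials in `x_1, x_2`.
[cite: NieDemmel2008, Example 3.5] -/
theorem isBlockSos_f₂ : IsBlockSos (Δ₂ : Set (Fin 3)) f₂ := by
  have h1 : (1 : Fin 3) ∈ (Δ₂ : Set (Fin 3)) := by simp [Δ₂]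
  have h2 : (2 : Fin 3) ∈ (Δ₂ : Set (Fin 3)) := by simp [Δ₂]
  have h := isBlockSos_sq_add_sq (Δ₂ : Set (Fin 3)) (X ⟨1, h1⟩ * X ⟨2, h2⟩) (X ⟨2, h2⟩ ^ 2 - 1)
  have heq : rename ((↑) : ↥(Δ₂ : Set (Fin 3)) → Fin 3)
      ((X ⟨1, h1⟩ * X ⟨2, h2⟩) ^ 2 + (X ⟨2, h2⟩ ^ 2 - 1) ^ 2) = f₂ := by
    simp only [map_add, map_pow, map_sub, map_mul, map_one, rename_X, f₂]
    ring
  rwa [heq] at h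

/-- ★ `f ≥ 1/4` on `ℝ³` (elementary case analysis: `x_2² ≤ 1/2` makes `(x_2² − 1)² ≥ 1/4`;
otherwise `x_1²x_2² ≥ x_1²/2` and one of `(x_0x_1 − 1)²`, `x_0⁴`, `x_1²/2` is `≥ 1/4`).  The paper's
`f* ≈ 0.8650` is not claimed. [cite: NieDemmel2008, Example 3.5 («Actually the minimum f* ≈ 0.8650»)] -/
theorem quarter_le_eval_f (x : Fin 3 → ℝ) : (1 : ℝ) / 4 ≤ eval x f := by
  rw [eval_f]
  set a := x 0
  set b := x 1
  set c := x 2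
  have h1 : 0 ≤ a ^ 4 := by positivity
  have h2 : 0 ≤ (a * b - 1) ^ 2 := sq_nonneg _
  have h3 : 0 ≤ b ^ 2 * c ^ 2 := by positivity
  have h4 : 0 ≤ (c ^ 2 - 1) ^ 2 := sq_nonneg _
  by_cases hc : c ^ 2 ≤ 1 / 2
  · have : (1 : ℝ) / 4 ≤ (c ^ 2 - 1) ^ 2 := by nlinarith
    linarith
  · rw [not_le] at hc
    have hbc : b ^ 2 / 2 ≤ b ^ 2 * c ^ 2 := by nlinarith [sq_nonneg b]
    by_cases hab : (1 : ℝ) / 4 ≤ (a * b - 1) ^ 2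
    · linarith
    · rw [not_le] at hab
      have hab' : (1 : ℝ) / 2 < a * b := by nlinarith
      by_cases ha : (1 : ℝ) / 2 ≤ a ^ 2
      · have : (1 : ℝ) / 4 ≤ a ^ 4 := by nlinarith
        linarith
      · rw [not_le] at ha
        have hab2 : (1 : ℝ) / 4 < a ^ 2 * b ^ 2 := by nlinarith
        have hb : (1 : ℝ) / 2 ≤ b ^ 2 := by
          by_contra hb
          rw [not_le] at hb
          nlinarith [sq_nonneg a, sq_nonneg b]
        linarith

/-- `f > 0` everywhere. [cite: NieDemmel2008, Example 3.5] -/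
theorem eval_f_pos (x : Fin 3 → ℝ) : 0 < eval x f :=
  lt_of_lt_of_le (by norm_num) (quarter_le_eval_f x)

/-! ### The obstruction: no sparse nonnegative certificate for `f − γ`, `γ > 0` -/

/-- The univariate trace of a polynomial on the line `x_0 = 0, x_2 = 0`: `P(y) = h(0, y, 0)`.
[cite: NieDemmel2008, Example 3.5] -/
def lineTrace (h : MvPolynomial (Fin 3) ℝ) : Polynomial ℝ :=
  aeval (fun i : Fin 3 => if i = 1 then Polynomial.X else 0) h

/-- The point `(0, y, 0)` of the line. [cite: NieDemmel2008, Example 3.5] -/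
def linePt (y : ℝ) : Fin 3 → ℝ := fun i => if i = 1 then y else 0

/-- `P(y) = h(0, y, 0)`. [cite: NieDemmel2008, Example 3.5] -/
theorem eval_lineTrace (h : MvPolynomial (Fin 3) ℝ) (y : ℝ) :
    (lineTrace h).eval y = eval (linePt y) h := by
  unfold lineTrace
  induction h using MvPolynomial.induction_on with
  | C a => simp
  | add p q hp hq => rw [map_add, Polynomial.eval_add, map_add, hp, hq]
  | mul_X p i hp =>
    rw [map_mul, Polynomial.eval_mul, map_mul, hp, aeval_X, eval_X]
    congr 1
    fin_cases i <;> simp [linePt]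

/-- A polynomial in `x_1` alone takes the value `P(x_1)` everywhere.
[cite: NieDemmel2008, Example 3.5] -/
theorem eval_eq_lineTrace {h : MvPolynomial (Fin 3) ℝ}
    (hh : h ∈ supported ℝ ({1} : Set (Fin 3))) (x : Fin 3 → ℝ) :
    eval x h = (lineTrace h).eval (x 1) := by
  rw [eval_lineTrace]
  exact eval_eq_of_mem_supported hh fun i hi => by
    rw [Set.mem_singleton_iff] at hi
    subst hi
    simp [linePt]

/-- A real polynomial bounded in absolute value on `ℝ` is constant.
[cite: NieDemmel2008, Example 3.5] -/
theorem polynomial_eq_C_of_bounded {P : Polynomial ℝ} {B : ℝ} (hB : ∀ y, |P.eval y| ≤ B) :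
    P = Polynomial.C (P.coeff 0) := by
  refine Polynomial.eq_C_of_degree_le_zero (not_lt.mp fun hdeg => ?_)
  have ht := P.tendsto_norm_atTop hdeg tendsto_norm_atTop_atTop
  obtain ⟨y, hy⟩ := (ht.eventually_gt_atTop B).exists
  have := hB y
  rw [Real.norm_eq_abs] at hy
  linarith

/-- ★★ **Example 3.5, exactly: no sparse nonnegative certificate.** For every `γ > 0` there are no
`σ₁ ∈ ℝ[x_0, x_1]`, `σ₂ ∈ ℝ[x_1, x_2]`, both nonnegative on `ℝ³` — in particular no sums of
squares of polynomials in the block variables, of ANY degree — with `f − γ = σ₁ + σ₂`.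
(Nie–Demmel report the numerical sparse bound `f*_Δ ≈ 5·10⁻⁵`; this is the exact statement
`f*_Δ = 0` behind it.) [cite: NieDemmel2008, Remark 3.4 and Example 3.5] [cite: MagronWang2022, Appendix «SOS + sparse + RIP ≠ sparse SOS» (arXiv p. 119)] -/
theorem no_sparse_nonneg_certificate {γ : ℝ} (hγ : 0 < γ) :
    ¬ ∃ σ₁ σ₂ : MvPolynomial (Fin 3) ℝ, σ₁ ∈ supported ℝ (Δ₁ : Set (Fin 3)) ∧
      σ₂ ∈ supported ℝ (Δ₂ : Set (Fin 3)) ∧ (∀ x, 0 ≤ eval x σ₁) ∧ (∀ x, 0 ≤ eval x σ₂) ∧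
      f - C γ = σ₁ + σ₂ := by
  rintro ⟨σ₁, σ₂, hs₁, hs₂, hp₁, hp₂, heq⟩
  -- `h = σ₁ − f₁ = f₂ − γ − σ₂` depends on `x_1` only
  set h : MvPolynomial (Fin 3) ℝ := σ₁ - f₁ with hdef
  have hh₂ : h = f₂ - C γ - σ₂ := by
    rw [hdef]
    have : f₁ + f₂ - C γ = σ₁ + σ₂ := by rw [← heq]; rfl
    linear_combination -this
  have hhA : h ∈ supported ℝ (Δ₁ : Set (Fin 3)) := Subalgebra.sub_mem _ hs₁ f₁_mem_supported
  have hhB : h ∈ supported ℝ (Δ₂ : Set (Fin 3)) := by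
    rw [hh₂]
    exact Subalgebra.sub_mem _ (Subalgebra.sub_mem _ f₂_mem_supported (C_mem_supported _ _)) hs₂
  have hh1 : h ∈ supported ℝ ({1} : Set (Fin 3)) := by
    rw [mem_supported] at hhA hhB ⊢
    intro i hi
    have hA := hhA hi
    have hB := hhB hi
    simp only [Δ₁, Δ₂, Finset.coe_insert, Finset.coe_singleton, Set.mem_insert_iff,
      Set.mem_singleton_iff] at hA hB
    rw [Set.mem_singleton_iff]
    rcases hA with hA | hA
    · rcases hB with hB | hB
      · rw [hA] at hB; exact absurd hB (by decide)
      · rw [hA] at hB; exact absurd hB (by decide)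
    · exact hA
  set P : Polynomial ℝ := lineTrace h with hP
  have hPev : ∀ x : Fin 3 → ℝ, eval x h = P.eval (x 1) := eval_eq_lineTrace hh1
  -- the bounds on `P`
  have hσ₁ : ∀ x : Fin 3 → ℝ, eval x σ₁ = eval x f₁ + P.eval (x 1) := by
    intro x
    have : σ₁ = f₁ + h := by rw [hdef]; ring
    rw [this, map_add, hPev]
  have hσ₂ : ∀ x : Fin 3 → ℝ, eval x σ₂ = eval x f₂ - γ - P.eval (x 1) := by
    intro x
    have : σ₂ = f₂ - C γ - h := by rw [hh₂]; ring
    rw [this, map_sub, map_sub, eval_C, hPev]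
  -- (a) `P ≤ 1 − γ`: `σ₂ ≥ 0` at `(*, y, 0)`
  have hup : ∀ y, P.eval y ≤ 1 - γ := by
    intro y
    have := hp₂ (fun i => if i = 1 then y else 0)
    rw [hσ₂, eval_f₂] at this
    simp at this
    linarith
  -- (b) `P ≥ −1`: `σ₁ ≥ 0` at `(0, y, *)`
  have hlow : ∀ y, -1 ≤ P.eval y := by
    intro y
    have := hp₁ (fun i => if i = 1 then y else 0)
    rw [hσ₁, eval_f₁] at this
    simp at this
    linarith
  -- so `P` is constant
  have hPc : P = Polynomial.C (P.coeff 0) := by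
    refine polynomial_eq_C_of_bounded (B := 1) fun y => abs_le.2 ⟨by linarith [hlow y], ?_⟩
    linarith [hup y]
  have hconst : ∀ y, P.eval y = P.coeff 0 := fun y => by
    rw [hPc]
    simp
  -- (c) `P(0) ≤ −γ`: `σ₂ ≥ 0` at `(0, 0, 1)`
  have hc : P.coeff 0 ≤ -γ := by
    have := hp₂ (fun i => if i = 2 then 1 else 0)
    rw [hσ₂, eval_f₂] at this
    simp at this
    rw [hconst] at this
    linarith
  -- (d) `P(y) ≥ −1/y⁴` at `x_0 = 1/y`: take `y = 1 + 1/γ`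
  have hγ' : 0 < 1 / γ := by positivity
  set y : ℝ := 1 + 1 / γ with hy
  have hy1 : 1 ≤ y := by rw [hy]; linarith
  have hy0 : 0 < y := by linarith
  have hd := hp₁ (fun i => if i = 0 then 1 / y else if i = 1 then y else 0)
  rw [hσ₁, eval_f₁] at hd
  simp only [Fin.isValue, ↓reduceIte, one_ne_zero] at hd
  rw [hconst, div_mul_cancel₀ _ (ne_of_gt hy0), sub_self, zero_pow two_ne_zero, add_zero] at hd
  -- `(1/y)^4 < γ`
  have hy4 : (1 / y) ^ 4 < γ := by
    have h1y : 1 / y ≤ 1 := by rw [div_le_one hy0]; exact hy1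
    have h1y0 : 0 < 1 / y := by positivity
    have hyγ : 1 / y < γ := by
      rw [div_lt_iff₀ hy0, hy]
      have : γ * (1 + 1 / γ) = γ + 1 := by field_simp
      rw [this]
      linarith
    calc (1 / y) ^ 4 = (1 / y) * ((1 / y) * ((1 / y) * (1 / y))) := by ring
      _ ≤ (1 / y) * (1 * (1 * 1)) := by gcongr
      _ = 1 / y := by ring
      _ < γ := hyγ
  linarith

/-- ★★ **The sparse SOS bound of Example 3.5 is exactly `0`, at every degree.**  The set of
`γ` certified by a sparse SOS decomposition `f − γ = σ₁ + σ₂`, `σ₁` a sum of squares of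
polynomials in `ℝ[x_0,x_1]`, `σ₂` one in `ℝ[x_1,x_2]` (no degree bound), is `{γ | γ ≤ 0}`:
`γ = 0` is attained (`f` itself is a sparse SOS) while `f ≥ 1/4` — so `f*_Δ = 0 < 1/4 ≤ f*`
(printed: `f*_Δ ≈ 5·10⁻⁵ < f*_sos ≈ 0.8499 < f* ≈ 0.8650`).
[cite: NieDemmel2008, Remark 3.4 and Example 3.5] -/
theorem sparseSosBound_eq_zero :
    {γ : ℝ | ∃ σ₁ σ₂ : MvPolynomial (Fin 3) ℝ, IsBlockSos (Δ₁ : Set (Fin 3)) σ₁ ∧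
      IsBlockSos (Δ₂ : Set (Fin 3)) σ₂ ∧ f - C γ = σ₁ + σ₂} = Set.Iic 0 := by
  ext γ
  simp only [Set.mem_setOf_eq, Set.mem_Iic]
  constructor
  · rintro ⟨σ₁, σ₂, h₁, h₂, heq⟩
    by_contra hγ
    rw [not_le] at hγ
    obtain ⟨hq₁, hm₁⟩ := h₁.isSumSq_and_mem
    obtain ⟨hq₂, hm₂⟩ := h₂.isSumSq_and_mem
    exact no_sparse_nonneg_certificate hγ ⟨σ₁, σ₂, hm₁, hm₂,
      fun x => Literature.Algebra.Polynomial.PutinarPositivstellensatz.eval_nonneg_of_isSumSq hq₁ x,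
      fun x => Literature.Algebra.Polynomial.PutinarPositivstellensatz.eval_nonneg_of_isSumSq hq₂ x,
      heq⟩
  · intro hγ
    -- `f − γ = (f₁ + (−γ)) + f₂` with `−γ ≥ 0` a square
    obtain ⟨q₁, hq₁, hq₁eq⟩ := isBlockSos_f₁
    refine ⟨f₁ + C (-γ), f₂, ?_, isBlockSos_f₂, by rw [f, map_neg]; ring⟩
    refine ⟨q₁ + C (Real.sqrt (-γ)) * C (Real.sqrt (-γ)), IsSumSq.add hq₁ (IsSumSq.mul_self _), ?_⟩
    rw [map_add, ← hq₁eq, map_mul, rename_C, ← C_mul, Real.mul_self_sqrt (by linarith)]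

/-! ### The contrast: with the ball constraints the certificate exists -/

/-- ★ **With compactness restored, sparse certificates exist** (Lasserre 2006 Cor. 3.9 with the
redundant constraints (3.1), the tree's `sparse_putinar_of_blockCover`): for every `γ < 1/4` and
every `N`, `f − γ = s₁ + t₁ (N − x_0² − x_1²) + s₂ + t₂ (N − x_1² − x_2²)` with `s₁, t₁` sums of
squares in `ℝ[x_0,x_1]` and `s₂, t₂` in `ℝ[x_1,x_2]` — exactly what Example 3.5 lacks is
compactness. [cite: NieDemmel2008, Example 3.5] [cite: Lasserre2006, Corollary 3.9 with (3.1)] -/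
theorem exists_sparse_certificate_with_balls {γ : ℝ} (hγ : γ < 1 / 4) (N : ℝ) :
    ∃ s₁ t₁ s₂ t₂ : MvPolynomial (Fin 3) ℝ, IsBlockSos (Δ₁ : Set (Fin 3)) s₁ ∧
      IsBlockSos (Δ₁ : Set (Fin 3)) t₁ ∧ IsBlockSos (Δ₂ : Set (Fin 3)) s₂ ∧
      IsBlockSos (Δ₂ : Set (Fin 3)) t₂ ∧
      f - C γ = s₁ + t₁ * blockBall Δ₁ N + (s₂ + t₂ * blockBall Δ₂ N) := by
  have hne : ∀ j, (blocks j).Nonempty := by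
    intro j
    fin_cases j
    · exact ⟨0, by simp [Δ₁]⟩
    · exact ⟨1, by simp [Δ₂]⟩
  obtain ⟨s₀, t, s, hs₀, ht, -, -, hcert⟩ := sparse_putinar_of_blockCover blocks hne
    indexedRunningIntersection_blocks ![f₁ - C γ, f₂]
    (by
      intro j
      fin_cases j
      · exact Subalgebra.sub_mem _ f₁_mem_supported (C_mem_supported _ _)
      · exact f₂_mem_supported)
    (κ := Fin 0) (fun k => Fin.elim0 k) (fun k => Fin.elim0 k) N
    (by
      intro x _ _
      have h := quarter_le_eval_f x
      rw [f, map_add] at h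
      simp only [Fin.sum_univ_two, Matrix.cons_val_zero, Matrix.cons_val_one, map_add, map_sub,
        eval_C]
      linarith)
  refine ⟨s₀ 0, t 0, s₀ 1, t 1, hs₀ 0, ht 0, hs₀ 1, ht 1, ?_⟩
  have hlhs : f - C γ = ∑ j : Fin 2, (![f₁ - C γ, f₂] : Fin 2 → MvPolynomial (Fin 3) ℝ) j := by
    simp only [Fin.sum_univ_two, Matrix.cons_val_zero, Matrix.cons_val_one, f]
    ring
  rw [hlhs, hcert]
  simp [Fin.sum_univ_two, Finset.univ_eq_empty, blocks]

end Literature.Algebra.Polynomial.SparseSosWithoutCompactness
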